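import Literature.MathematicalPhysics.QuantumLattice.HubbardSliceSymbolSmoothMomentum
import HarnessLib

/-!
# The slice symbol as a function of the band variable: the THIRD derivative, `‖∂_ξ³ Ψ̂‖ ≲ βL²/Λ⁴`

Topic `MathematicalPhysics/QuantumLattice`; continues `HubbardSliceSymbolSmooth` / `HubbardSliceSymbolSmoothMomentum` (cell gate-hubbard-kl;
R0-SCOPE-4 W2c), which differentiate the single-scale symbol `Ψ̂_ω(ξ) = W(ξ)·R(ξ)`, `W = χ₂((ξ²+ω²)/Λ²) − χ₂((ξ²+ω²)/Λ′²)`,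
`R = c/(−i(ω+θ)+ξ)` TWICE (`‖Ψ̂″‖ ≤ (32B₂+144B₁+128)c/Λ³`).  The WEIGHTED (first-moment) `ℓ¹` norms of the sectorised slice propagators
(KL STATUS located risk «(b)-Wt@j≥1»; `Summits/…/KLProgrammeKLRegimeTorusL1ThirdDifferencesMoment.sum_wt_norm_charSum_le_of_third_differences`)
need single-direction THIRD differences of the symbol, hence the third derivative here (Benfatto–Giuliani–Mastropietro 2006, (2.36aa):
each momentum/frequency derivative of a scale-`Λ` symbol costs `Λ⁻¹`):

* §1 `hasDerivAt_deriv_deriv_salmhoferCutoff`, `deriv_deriv_deriv_salmhoferCutoff_eq_zero_of_lt/_gt`, `exists_deriv3_bound_salmhoferCutoff` —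
  the cutoff's third derivative (smooth; vanishes off `[¼, 1]`; globally bounded);
* §2 `sliceWeightFnD3`, **`hasDerivAt_sliceWeightFnD2`**, `abs_deriv3_term_le`, **`abs_sliceWeightFnD3_le`** (`|W‴| ≤ (16B₃ + 24B₂)/Λ³`),
  `sliceWeightFnD3_eq_zero_of_not_mem`;
* §3 `resolventFnXiD3 = −6c/(−i(ω+θ)+ξ)⁴`, **`hasDerivAt_resolventFnXiD2`**, `norm_resolventFnXiD3`;
* §4 `sliceSymbolFnXiD3 = W‴R + 3W″R′ + 3W′R″ + WR‴`, **`hasDerivAt_sliceSymbolFnXiD2`** (everywhere), and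
  **`norm_sliceSymbolFnXiD3_le`**: `‖Ψ̂‴‖ ≤ (64B₃ + 480B₂ + 1728B₁ + 1536)·c/Λ⁴` (`c ≥ 0`, `0 < Λ ≤ Λ′`, `|θ| ≤ Λ/4`).

Everything is proved; the three functions `sliceWeightFnD3`, `resolventFnXiD3`, `sliceSymbolFnXiD3` are the only definitions; no named facts.

## Sources

G. Benfatto, A. Giuliani, V. Mastropietro, Ann. Henri Poincaré 7 (2006) 809–898, (2.36aa), (2.50), (2.52) (`BenfattoGiulianiMastropietro2006`);
M. Salmhofer, *Renormalization* (1999), §4.2.5 (4.70)–(4.71) (`Salmhofer1999`).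
-/

noncomputable section

namespace Literature.MathematicalPhysics.QuantumLattice

open Literature.Probability.LatticeModels Set Complex

/-! ### §1 The third derivative of Salmhofer's cutoff -/

/-- `χ₂″` is differentiable with derivative `deriv (deriv (deriv χ₂))`. [cite: Salmhofer1999, §4.2.5 (4.71)] -/
theorem hasDerivAt_deriv_deriv_salmhoferCutoff (x : ℝ) :
    HasDerivAt (deriv (deriv salmhoferCutoff)) (deriv (deriv (deriv salmhoferCutoff)) x) x := by
  have h3 : ContDiff ℝ 3 salmhoferCutoff := contDiff_salmhoferCutoff
  have h2 : ContDiff ℝ 2 (deriv salmhoferCutoff) := by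
    rw [show (3 : WithTop ℕ∞) = 2 + 1 by norm_num] at h3
    exact (contDiff_succ_iff_deriv.1 h3).2.2
  have h1 : ContDiff ℝ 1 (deriv (deriv salmhoferCutoff)) := by
    rw [show (2 : WithTop ℕ∞) = 1 + 1 by norm_num] at h2
    exact (contDiff_succ_iff_deriv.1 h2).2.2
  exact (h1.differentiable one_ne_zero x).hasDerivAt

/-- `χ₂‴ = 0` below `¼`. [cite: Salmhofer1999, §4.2.5 (4.71)] -/
theorem deriv_deriv_deriv_salmhoferCutoff_eq_zero_of_lt {x : ℝ} (hx : x < 1 / 4) :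
    deriv (deriv (deriv salmhoferCutoff)) x = 0 := by
  have hev : deriv (deriv salmhoferCutoff) =ᶠ[nhds x] fun _ => (0 : ℝ) := by
    filter_upwards [Iio_mem_nhds hx] with y hy
    exact deriv_deriv_salmhoferCutoff_eq_zero_of_lt hy
  rw [hev.deriv_eq, deriv_const]

/-- `χ₂‴ = 0` above `1`. [cite: Salmhofer1999, §4.2.5 (4.71)] -/
theorem deriv_deriv_deriv_salmhoferCutoff_eq_zero_of_gt {x : ℝ} (hx : 1 < x) :
    deriv (deriv (deriv salmhoferCutoff)) x = 0 := by
  have hev : deriv (deriv salmhoferCutoff) =ᶠ[nhds x] fun _ => (0 : ℝ) := by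
    filter_upwards [Ioi_mem_nhds hx] with y hy
    exact deriv_deriv_salmhoferCutoff_eq_zero_of_gt hy
  rw [hev.deriv_eq, deriv_const]

/-- **A global bound for the third derivative of Salmhofer's cutoff**: `∃ B₃ ≥ 0, |χ₂‴| ≤ B₃` (continuous and vanishing off `[0, 2]`).
[cite: Salmhofer1999, §4.2.5 (4.71)] -/
theorem exists_deriv3_bound_salmhoferCutoff :
    ∃ B₃ : ℝ, 0 ≤ B₃ ∧ ∀ x, |deriv (deriv (deriv salmhoferCutoff)) x| ≤ B₃ := by
  have h3 : ContDiff ℝ 3 salmhoferCutoff := contDiff_salmhoferCutoff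
  have h2 : ContDiff ℝ 2 (deriv salmhoferCutoff) := by
    rw [show (3 : WithTop ℕ∞) = 2 + 1 by norm_num] at h3
    exact (contDiff_succ_iff_deriv.1 h3).2.2
  have h1 : ContDiff ℝ 1 (deriv (deriv salmhoferCutoff)) := by
    rw [show (2 : WithTop ℕ∞) = 1 + 1 by norm_num] at h2
    exact (contDiff_succ_iff_deriv.1 h2).2.2
  have hc3 : Continuous (deriv (deriv (deriv salmhoferCutoff))) := h1.continuous_deriv le_rfl
  obtain ⟨C₃, hC₃⟩ := (isCompact_Icc : IsCompact (Icc (0 : ℝ) 2)).exists_bound_of_continuousOn hc3.continuousOn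
  have hout : ∀ x : ℝ, x ∉ Icc (0 : ℝ) 2 → deriv (deriv (deriv salmhoferCutoff)) x = 0 := by
    intro x hx
    rw [Set.mem_Icc, not_and_or, not_le, not_le] at hx
    rcases hx with hx | hx
    · exact deriv_deriv_deriv_salmhoferCutoff_eq_zero_of_lt (by linarith)
    · exact deriv_deriv_deriv_salmhoferCutoff_eq_zero_of_gt (by linarith)
  refine ⟨max C₃ 0, le_max_right _ _, fun x => ?_⟩
  by_cases hx : x ∈ Icc (0 : ℝ) 2
  · exact (Real.norm_eq_abs _ ▸ hC₃ x hx).trans (le_max_left _ _)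
  · rw [hout x hx, abs_zero]; exact le_max_right _ _

/-! ### §2 The third derivative of the slice weight -/

/-- The third derivative of the slice weight `W(ω) = χ₂((ω²+ξ²)/Λ²) − χ₂((ω²+ξ²)/Λ′²)`:
per cutoff term `χ₂‴(u)·(2ω/Λ²)³ + 3·χ₂″(u)·(2ω/Λ²)·(2/Λ²)`, `u = (ω²+ξ²)/Λ²`. [cite: Salmhofer1999, §4.2.5 (4.70)] -/
def sliceWeightFnD3 (Λ Λ' ξ ω : ℝ) : ℝ :=
  (deriv (deriv (deriv salmhoferCutoff)) ((ω ^ 2 + ξ ^ 2) / Λ ^ 2) * (2 * ω / Λ ^ 2) * (2 * ω / Λ ^ 2) * (2 * ω / Λ ^ 2) +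
      3 * (deriv (deriv salmhoferCutoff) ((ω ^ 2 + ξ ^ 2) / Λ ^ 2) * (2 * ω / Λ ^ 2) * (2 / Λ ^ 2))) -
    (deriv (deriv (deriv salmhoferCutoff)) ((ω ^ 2 + ξ ^ 2) / Λ' ^ 2) * (2 * ω / Λ' ^ 2) * (2 * ω / Λ' ^ 2) * (2 * ω / Λ' ^ 2) +
      3 * (deriv (deriv salmhoferCutoff) ((ω ^ 2 + ξ ^ 2) / Λ' ^ 2) * (2 * ω / Λ' ^ 2) * (2 / Λ' ^ 2)))

/-- One cutoff term of `W″` has derivative the corresponding term of `W‴`. [cite: Salmhofer1999, §4.2.5 (4.70)] -/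
theorem hasDerivAt_deriv2_term (Λ ξ ω : ℝ) :
    HasDerivAt (fun t : ℝ => deriv (deriv salmhoferCutoff) ((t ^ 2 + ξ ^ 2) / Λ ^ 2) * (2 * t / Λ ^ 2) * (2 * t / Λ ^ 2) +
        deriv salmhoferCutoff ((t ^ 2 + ξ ^ 2) / Λ ^ 2) * (2 / Λ ^ 2))
      (deriv (deriv (deriv salmhoferCutoff)) ((ω ^ 2 + ξ ^ 2) / Λ ^ 2) * (2 * ω / Λ ^ 2) * (2 * ω / Λ ^ 2) * (2 * ω / Λ ^ 2) +
        3 * (deriv (deriv salmhoferCutoff) ((ω ^ 2 + ξ ^ 2) / Λ ^ 2) * (2 * ω / Λ ^ 2) * (2 / Λ ^ 2))) ω := by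
  have hlin : HasDerivAt (fun t : ℝ => 2 * t / Λ ^ 2) (2 / Λ ^ 2) ω := by
    simpa using ((hasDerivAt_id ω).const_mul 2).div_const (Λ ^ 2)
  have hA : HasDerivAt (fun t : ℝ => deriv (deriv salmhoferCutoff) ((t ^ 2 + ξ ^ 2) / Λ ^ 2))
      (deriv (deriv (deriv salmhoferCutoff)) ((ω ^ 2 + ξ ^ 2) / Λ ^ 2) * (2 * ω / Λ ^ 2)) ω :=
    (hasDerivAt_deriv_deriv_salmhoferCutoff _).comp ω (hasDerivAt_sqArg Λ ξ ω)
  have hB : HasDerivAt (fun t : ℝ => deriv salmhoferCutoff ((t ^ 2 + ξ ^ 2) / Λ ^ 2))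
      (deriv (deriv salmhoferCutoff) ((ω ^ 2 + ξ ^ 2) / Λ ^ 2) * (2 * ω / Λ ^ 2)) ω :=
    (hasDerivAt_deriv_salmhoferCutoff _).comp ω (hasDerivAt_sqArg Λ ξ ω)
  refine (((hA.mul hlin).mul hlin).add (hB.mul_const (2 / Λ ^ 2))).congr_deriv ?_
  simp only [Pi.mul_apply]
  ring

/-- **`W‴ = sliceWeightFnD3`.** [cite: Salmhofer1999, §4.2.5 (4.70)] -/
theorem hasDerivAt_sliceWeightFnD2 (Λ Λ' ξ ω : ℝ) :
    HasDerivAt (sliceWeightFnD2 Λ Λ' ξ) (sliceWeightFnD3 Λ Λ' ξ ω) ω := by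
  unfold sliceWeightFnD2 sliceWeightFnD3
  exact (hasDerivAt_deriv2_term Λ ξ ω).sub (hasDerivAt_deriv2_term Λ' ξ ω)

section WeightBounds

variable {B₂ B₃ : ℝ}

/-- The third-order chain-rule terms of ONE cutoff: `|χ₂‴(u)(2ω/Λ²)³ + 3χ₂″(u)(2ω/Λ²)(2/Λ²)| ≤ (8B₃ + 12B₂)/Λ³` (both derivatives vanish
unless `ω² ≤ ω² + ξ² ≤ Λ²`). [cite: BenfattoGiulianiMastropietro2006, (2.36aa)] -/
theorem abs_deriv3_term_le (hB₂ : ∀ x, |deriv (deriv salmhoferCutoff) x| ≤ B₂)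
    (hB₃ : ∀ x, |deriv (deriv (deriv salmhoferCutoff)) x| ≤ B₃) {Λ : ℝ} (hΛ : 0 < Λ) (ξ ω : ℝ) :
    |deriv (deriv (deriv salmhoferCutoff)) ((ω ^ 2 + ξ ^ 2) / Λ ^ 2) * (2 * ω / Λ ^ 2) * (2 * ω / Λ ^ 2) * (2 * ω / Λ ^ 2) +
        3 * (deriv (deriv salmhoferCutoff) ((ω ^ 2 + ξ ^ 2) / Λ ^ 2) * (2 * ω / Λ ^ 2) * (2 / Λ ^ 2))| ≤
      (8 * B₃ + 12 * B₂) / Λ ^ 3 := by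
  have hB20 : 0 ≤ B₂ := (abs_nonneg _).trans (hB₂ 0)
  have hB30 : 0 ≤ B₃ := (abs_nonneg _).trans (hB₃ 0)
  by_cases hgt : 1 < (ω ^ 2 + ξ ^ 2) / Λ ^ 2
  · rw [deriv_deriv_deriv_salmhoferCutoff_eq_zero_of_gt hgt, deriv_deriv_salmhoferCutoff_eq_zero_of_gt hgt]
    simp only [zero_mul, mul_zero, add_zero, abs_zero]
    positivity
  · have hω2 : ω ^ 2 ≤ Λ ^ 2 := by
      rw [not_lt, div_le_one (by positivity)] at hgt
      nlinarith [sq_nonneg ξ]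
    have hωabs : |ω| ≤ Λ := by
      obtain ⟨h1, h2⟩ := abs_le_of_sq_le_sq' hω2 hΛ.le
      exact abs_le.2 ⟨h1, h2⟩
    have hfirst : |deriv (deriv (deriv salmhoferCutoff)) ((ω ^ 2 + ξ ^ 2) / Λ ^ 2) * (2 * ω / Λ ^ 2) * (2 * ω / Λ ^ 2) *
        (2 * ω / Λ ^ 2)| ≤ 8 * B₃ / Λ ^ 3 := by
      rw [mul_assoc, mul_assoc, abs_mul]
      have hcube : |2 * ω / Λ ^ 2 * (2 * ω / Λ ^ 2 * (2 * ω / Λ ^ 2))| ≤ 8 / Λ ^ 3 := by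
        rw [show 2 * ω / Λ ^ 2 * (2 * ω / Λ ^ 2 * (2 * ω / Λ ^ 2)) = 8 * ω ^ 3 / (Λ ^ 2) ^ 3 by field_simp; ring, abs_div,
          abs_of_pos (by positivity : (0 : ℝ) < (Λ ^ 2) ^ 3), abs_mul, abs_of_pos (by norm_num : (0 : ℝ) < 8), abs_pow,
          div_le_div_iff₀ (by positivity) (by positivity)]
        have h3 : |ω| ^ 3 ≤ Λ ^ 3 := pow_le_pow_left₀ (abs_nonneg _) hωabs 3
        nlinarith [pow_pos hΛ 3, pow_pos hΛ 2]
      calc |deriv (deriv (deriv salmhoferCutoff)) ((ω ^ 2 + ξ ^ 2) / Λ ^ 2)| * |2 * ω / Λ ^ 2 * (2 * ω / Λ ^ 2 * (2 * ω / Λ ^ 2))|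
          ≤ B₃ * (8 / Λ ^ 3) := mul_le_mul (hB₃ _) hcube (abs_nonneg _) hB30
        _ = 8 * B₃ / Λ ^ 3 := by ring
    have hsecond : |3 * (deriv (deriv salmhoferCutoff) ((ω ^ 2 + ξ ^ 2) / Λ ^ 2) * (2 * ω / Λ ^ 2) * (2 / Λ ^ 2))| ≤
        12 * B₂ / Λ ^ 3 := by
      rw [abs_mul, abs_of_pos (by norm_num : (0 : ℝ) < 3), mul_assoc, abs_mul]
      have hlin : |2 * ω / Λ ^ 2 * (2 / Λ ^ 2)| ≤ 4 / Λ ^ 3 := by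
        rw [show 2 * ω / Λ ^ 2 * (2 / Λ ^ 2) = 4 * ω / (Λ ^ 2 * Λ ^ 2) by field_simp; ring, abs_div,
          abs_of_pos (by positivity : (0 : ℝ) < Λ ^ 2 * Λ ^ 2), abs_mul, abs_of_pos (by norm_num : (0 : ℝ) < 4),
          div_le_div_iff₀ (by positivity) (by positivity)]
        nlinarith [pow_pos hΛ 3, pow_pos hΛ 2, abs_nonneg ω]
      calc 3 * (|deriv (deriv salmhoferCutoff) ((ω ^ 2 + ξ ^ 2) / Λ ^ 2)| * |2 * ω / Λ ^ 2 * (2 / Λ ^ 2)|)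
          ≤ 3 * (B₂ * (4 / Λ ^ 3)) := mul_le_mul_of_nonneg_left (mul_le_mul (hB₂ _) hlin (abs_nonneg _) hB20) (by norm_num)
        _ = 12 * B₂ / Λ ^ 3 := by ring
    calc _ ≤ |deriv (deriv (deriv salmhoferCutoff)) ((ω ^ 2 + ξ ^ 2) / Λ ^ 2) * (2 * ω / Λ ^ 2) * (2 * ω / Λ ^ 2) * (2 * ω / Λ ^ 2)| +
          |3 * (deriv (deriv salmhoferCutoff) ((ω ^ 2 + ξ ^ 2) / Λ ^ 2) * (2 * ω / Λ ^ 2) * (2 / Λ ^ 2))| := abs_add_le _ _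
      _ ≤ 8 * B₃ / Λ ^ 3 + 12 * B₂ / Λ ^ 3 := add_le_add hfirst hsecond
      _ = (8 * B₃ + 12 * B₂) / Λ ^ 3 := by ring

/-- **`|W‴| ≤ (16B₃ + 24B₂)/Λ³`** (`0 < Λ ≤ Λ′`). [cite: BenfattoGiulianiMastropietro2006, (2.36aa)] -/
theorem abs_sliceWeightFnD3_le (hB₂ : ∀ x, |deriv (deriv salmhoferCutoff) x| ≤ B₂)
    (hB₃ : ∀ x, |deriv (deriv (deriv salmhoferCutoff)) x| ≤ B₃) {Λ Λ' : ℝ} (hΛ : 0 < Λ) (hΛΛ' : Λ ≤ Λ') (ξ ω : ℝ) :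
    |sliceWeightFnD3 Λ Λ' ξ ω| ≤ (16 * B₃ + 24 * B₂) / Λ ^ 3 := by
  have hB20 : 0 ≤ B₂ := (abs_nonneg _).trans (hB₂ 0)
  have hB30 : 0 ≤ B₃ := (abs_nonneg _).trans (hB₃ 0)
  have hΛ' : 0 < Λ' := hΛ.trans_le hΛΛ'
  unfold sliceWeightFnD3
  refine (abs_sub _ _).trans ?_
  have h1 := abs_deriv3_term_le hB₂ hB₃ hΛ ξ ω
  have h2 := abs_deriv3_term_le hB₂ hB₃ hΛ' ξ ω
  have h3 : (8 * B₃ + 12 * B₂) / Λ' ^ 3 ≤ (8 * B₃ + 12 * B₂) / Λ ^ 3 :=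
    div_le_div_of_nonneg_left (by positivity) (by positivity) (pow_le_pow_left₀ hΛ.le hΛΛ' 3)
  calc _ ≤ (8 * B₃ + 12 * B₂) / Λ ^ 3 + (8 * B₃ + 12 * B₂) / Λ' ^ 3 := add_le_add h1 h2
    _ ≤ (8 * B₃ + 12 * B₂) / Λ ^ 3 + (8 * B₃ + 12 * B₂) / Λ ^ 3 := by linarith
    _ = (16 * B₃ + 24 * B₂) / Λ ^ 3 := by ring

end WeightBounds

/-- **Off the closed shell `Λ²/4 ≤ ω²+ξ² ≤ Λ′²` the third derivative of the weight vanishes too** (`0 < Λ ≤ Λ′`).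
[cite: Salmhofer1999, §4.2.5 (4.71)] -/
theorem sliceWeightFnD3_eq_zero_of_not_mem {Λ Λ' : ℝ} (hΛ : 0 < Λ) (hΛΛ' : Λ ≤ Λ') {ξ ω : ℝ}
    (h : ω ^ 2 + ξ ^ 2 < Λ ^ 2 / 4 ∨ Λ' ^ 2 < ω ^ 2 + ξ ^ 2) : sliceWeightFnD3 Λ Λ' ξ ω = 0 := by
  have hΛ' : 0 < Λ' := hΛ.trans_le hΛΛ'
  have hΛ2 : Λ ^ 2 ≤ Λ' ^ 2 := pow_le_pow_left₀ hΛ.le hΛΛ' 2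
  unfold sliceWeightFnD3
  rcases h with h | h
  · have h1 : (ω ^ 2 + ξ ^ 2) / Λ ^ 2 < 1 / 4 := by rw [div_lt_iff₀ (by positivity)]; linarith
    have h2 : (ω ^ 2 + ξ ^ 2) / Λ' ^ 2 < 1 / 4 := by
      rw [div_lt_iff₀ (by positivity)]; nlinarith [sq_nonneg ω, sq_nonneg ξ]
    simp [deriv_deriv_salmhoferCutoff_eq_zero_of_lt h1, deriv_deriv_salmhoferCutoff_eq_zero_of_lt h2,
      deriv_deriv_deriv_salmhoferCutoff_eq_zero_of_lt h1, deriv_deriv_deriv_salmhoferCutoff_eq_zero_of_lt h2]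
  · have h1 : 1 < (ω ^ 2 + ξ ^ 2) / Λ ^ 2 := by rw [lt_div_iff₀ (by positivity)]; linarith
    have h2 : 1 < (ω ^ 2 + ξ ^ 2) / Λ' ^ 2 := by rw [lt_div_iff₀ (by positivity)]; linarith
    simp [deriv_deriv_salmhoferCutoff_eq_zero_of_gt h1, deriv_deriv_salmhoferCutoff_eq_zero_of_gt h2,
      deriv_deriv_deriv_salmhoferCutoff_eq_zero_of_gt h1, deriv_deriv_deriv_salmhoferCutoff_eq_zero_of_gt h2]

/-! ### §3 The third `ξ`-derivative of the resolvent factor -/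

/-- `∂_ξ³ R = −6c/(−i(ω+θ)+ξ)⁴`. [cite: BenfattoGiulianiMastropietro2006, §2.1 (2.3)] -/
def resolventFnXiD3 (c θ ω ξ : ℝ) : ℂ := -6 * (c : ℂ) / (-I * ((ω + θ : ℝ) : ℂ) + (ξ : ℂ)) ^ 4

/-- `∂_ξ³ R = resolventFnXiD3` off the pole. [cite: BenfattoGiulianiMastropietro2006, §2.1 (2.3)] -/
theorem hasDerivAt_resolventFnXiD2 {c θ ω ξ : ℝ} (h : (-I * ((ω + θ : ℝ) : ℂ) + (ξ : ℂ)) ≠ 0) :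
    HasDerivAt (resolventFnXiD2 c θ ω) (resolventFnXiD3 c θ ω ξ) ξ := by
  unfold resolventFnXiD2 resolventFnXiD3
  have h3 : (-I * ((ω + θ : ℝ) : ℂ) + (ξ : ℂ)) ^ 3 ≠ 0 := pow_ne_zero 3 h
  have hcb : HasDerivAt (fun t : ℝ => (-I * ((ω + θ : ℝ) : ℂ) + (t : ℂ)) ^ 3)
      ((3 : ℕ) * (-I * ((ω + θ : ℝ) : ℂ) + (ξ : ℂ)) ^ (3 - 1) * 1) ξ :=
    (hasDerivAt_shiftDen_xi θ ω ξ).pow 3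
  have hinv := ((hasDerivAt_inv h3).comp ξ hcb).const_mul (2 * (c : ℂ))
  refine (hinv.congr_of_eventuallyEq (Filter.Eventually.of_forall fun t => ?_)).congr_deriv ?_
  · simp only [Function.comp, div_eq_mul_inv]
  · set a : ℂ := -I * ((ω + θ : ℝ) : ℂ) + (ξ : ℂ) with ha
    have h4 : a ^ 4 ≠ 0 := pow_ne_zero 4 h
    have h6 : (a ^ 3) ^ 2 ≠ 0 := pow_ne_zero 2 h3
    rw [show (3 : ℕ) - 1 = 2 from rfl]
    field_simp
    ring

/-- `‖∂_ξ³ R‖ = 6c/|a|⁴`. [cite: BenfattoGiulianiMastropietro2006, §2.1 (2.3)] -/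
theorem norm_resolventFnXiD3 {c : ℝ} (hc : 0 ≤ c) (θ ω ξ : ℝ) :
    ‖resolventFnXiD3 c θ ω ξ‖ = 6 * c / ‖-I * ((ω + θ : ℝ) : ℂ) + (ξ : ℂ)‖ ^ 4 := by
  rw [resolventFnXiD3, norm_div, norm_mul, norm_neg, Complex.norm_real, Real.norm_eq_abs, abs_of_nonneg hc, norm_pow]
  norm_num

/-! ### §4 The third `ξ`-derivative of the slice symbol -/

/-- `Ψ̂‴ = W‴R + 3W″R′ + 3W′R″ + WR‴`. [cite: Salmhofer1999, §4.2.5 (4.70)] -/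
def sliceSymbolFnXiD3 (c θ Λ Λ' ω ξ : ℝ) : ℂ :=
  (sliceWeightFnD3 Λ Λ' ω ξ : ℂ) * resolventFnXi c θ ω ξ + 3 * ((sliceWeightFnD2 Λ Λ' ω ξ : ℂ) * resolventFnXiD1 c θ ω ξ) +
    3 * ((sliceWeightFnD1 Λ Λ' ω ξ : ℂ) * resolventFnXiD2 c θ ω ξ) + (sliceWeightFn Λ Λ' ω ξ : ℂ) * resolventFnXiD3 c θ ω ξ

section Xi

variable {c θ Λ Λ' ω : ℝ}

/-- **`Ψ̂″` is differentiable in `ξ` everywhere, with derivative `Ψ̂‴`.** [cite: BenfattoGiulianiMastropietro2006, (2.36aa)] -/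
theorem hasDerivAt_sliceSymbolFnXiD2 (hΛ : 0 < Λ) (hΛΛ' : Λ ≤ Λ') (hθ : |θ| ≤ Λ / 4) (ξ : ℝ) :
    HasDerivAt (sliceSymbolFnXiD2 c θ Λ Λ' ω) (sliceSymbolFnXiD3 c θ Λ Λ' ω ξ) ξ := by
  by_cases h : Λ ^ 2 / 5 < ξ ^ 2 + ω ^ 2
  · have hne := shiftDen_ne_zero_of_gt_xi hθ h
    unfold sliceSymbolFnXiD2 sliceSymbolFnXiD3
    have hA := (hasDerivAt_sliceWeightFnD2 Λ Λ' ω ξ).ofReal_comp.mul (hasDerivAt_resolventFnXi (c := c) hne)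
    have hB := ((hasDerivAt_sliceWeightFnD1 Λ Λ' ω ξ).ofReal_comp.mul (hasDerivAt_resolventFnXiD1 (c := c) hne)).const_mul (2 : ℂ)
    have hC := (hasDerivAt_sliceWeightFn Λ Λ' ω ξ).ofReal_comp.mul (hasDerivAt_resolventFnXiD2 (c := c) hne)
    refine ((hA.add hB).add hC).congr_deriv ?_
    ring
  · have hlt : ξ ^ 2 + ω ^ 2 < Λ ^ 2 / 4 := by linarith [not_lt.1 h, pow_pos hΛ 2]
    have hopen : ∀ᶠ t in nhds ξ, t ^ 2 + ω ^ 2 < Λ ^ 2 / 4 :=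
      (continuous_pow 2 |>.add continuous_const).continuousAt.eventually_lt continuousAt_const hlt
    have hev : sliceSymbolFnXiD2 c θ Λ Λ' ω =ᶠ[nhds ξ] fun _ => (0 : ℂ) := by
      filter_upwards [hopen] with t ht
      obtain ⟨h0, h1, h2⟩ := sliceWeightFn_eq_zero_of_not_mem hΛ hΛΛ' (ξ := ω) (ω := t) (Or.inl ht)
      rw [sliceSymbolFnXiD2, h0, h1, h2, Complex.ofReal_zero]
      ring
    have hD3 : sliceSymbolFnXiD3 c θ Λ Λ' ω ξ = 0 := by
      obtain ⟨h0, h1, h2⟩ := sliceWeightFn_eq_zero_of_not_mem hΛ hΛΛ' (ξ := ω) (ω := ξ) (Or.inl hlt)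
      have h3 := sliceWeightFnD3_eq_zero_of_not_mem hΛ hΛΛ' (ξ := ω) (ω := ξ) (Or.inl hlt)
      rw [sliceSymbolFnXiD3, h0, h1, h2, h3, Complex.ofReal_zero]
      ring
    rw [hD3]
    exact (hasDerivAt_const ξ (0 : ℂ)).congr_of_eventuallyEq hev

/-- **`‖Ψ̂‴‖ ≤ (64B₃ + 480B₂ + 1728B₁ + 1536)·c/Λ⁴`** everywhere (`c ≥ 0`, `0 < Λ ≤ Λ′`, `|θ| ≤ Λ/4`; `B₁, B₂, B₃` bounds of
`χ₂′, χ₂″, χ₂‴`). [cite: BenfattoGiulianiMastropietro2006, (2.36aa)] -/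
theorem norm_sliceSymbolFnXiD3_le (hΛ : 0 < Λ) (hΛΛ' : Λ ≤ Λ') (hθ : |θ| ≤ Λ / 4) (hc : 0 ≤ c) {B₁ B₂ B₃ : ℝ}
    (hB₁ : ∀ x, |deriv salmhoferCutoff x| ≤ B₁) (hB₂ : ∀ x, |deriv (deriv salmhoferCutoff) x| ≤ B₂)
    (hB₃ : ∀ x, |deriv (deriv (deriv salmhoferCutoff)) x| ≤ B₃) (ξ : ℝ) :
    ‖sliceSymbolFnXiD3 c θ Λ Λ' ω ξ‖ ≤ (64 * B₃ + 480 * B₂ + 1728 * B₁ + 1536) * c / Λ ^ 4 := by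
  have hB10 : 0 ≤ B₁ := (abs_nonneg _).trans (hB₁ 0)
  have hB20 : 0 ≤ B₂ := (abs_nonneg _).trans (hB₂ 0)
  have hB30 : 0 ≤ B₃ := (abs_nonneg _).trans (hB₃ 0)
  by_cases hmem : ξ ^ 2 + ω ^ 2 < Λ ^ 2 / 4 ∨ Λ' ^ 2 < ξ ^ 2 + ω ^ 2
  · obtain ⟨h0, h1, h2⟩ := sliceWeightFn_eq_zero_of_not_mem hΛ hΛΛ' hmem
    have h3 := sliceWeightFnD3_eq_zero_of_not_mem hΛ hΛΛ' hmem
    rw [sliceSymbolFnXiD3, h0, h1, h2, h3, Complex.ofReal_zero]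
    simp only [zero_mul, mul_zero, add_zero, norm_zero]
    positivity
  · rw [not_or, not_lt, not_lt] at hmem
    have hden := norm_shiftDen_ge hθ (show Λ ^ 2 / 4 ≤ ω ^ 2 + ξ ^ 2 by linarith [hmem.1])
    set a := ‖-I * ((ω + θ : ℝ) : ℂ) + (ξ : ℂ)‖ with ha
    have ha0 : 0 < a := lt_of_lt_of_le (by positivity) hden
    have hR : ‖resolventFnXi c θ ω ξ‖ ≤ 4 * c / Λ := by
      rw [norm_resolventFnXi hc, div_le_div_iff₀ ha0 hΛ]; nlinarith
    have hR1 : ‖resolventFnXiD1 c θ ω ξ‖ ≤ 16 * c / Λ ^ 2 := by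
      rw [norm_resolventFnXiD1 hc, div_le_div_iff₀ (by positivity) (by positivity)]
      have : Λ ^ 2 ≤ 16 * a ^ 2 := by nlinarith
      nlinarith
    have hR2 : ‖resolventFnXiD2 c θ ω ξ‖ ≤ 128 * c / Λ ^ 3 := by
      rw [norm_resolventFnXiD2 hc, div_le_div_iff₀ (by positivity) (by positivity)]
      have : Λ ^ 3 ≤ 64 * a ^ 3 := by nlinarith [pow_le_pow_left₀ (by positivity : 0 ≤ Λ / 4) hden 3]
      nlinarith
    have hR3 : ‖resolventFnXiD3 c θ ω ξ‖ ≤ 1536 * c / Λ ^ 4 := by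
      rw [norm_resolventFnXiD3 hc, div_le_div_iff₀ (by positivity) (by positivity)]
      have : Λ ^ 4 ≤ 256 * a ^ 4 := by nlinarith [pow_le_pow_left₀ (by positivity : 0 ≤ Λ / 4) hden 4]
      nlinarith
    have hW : ‖(sliceWeightFn Λ Λ' ω ξ : ℂ)‖ ≤ 1 := by
      rw [Complex.norm_real, Real.norm_eq_abs]; exact abs_sliceWeightFn_le_one Λ Λ' ω ξ
    have hW1 : ‖(sliceWeightFnD1 Λ Λ' ω ξ : ℂ)‖ ≤ 4 * B₁ / Λ := by
      rw [Complex.norm_real, Real.norm_eq_abs]; exact abs_sliceWeightFnD1_le hB₁ hΛ hΛΛ' ω ξ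
    have hW2 : ‖(sliceWeightFnD2 Λ Λ' ω ξ : ℂ)‖ ≤ (8 * B₂ + 4 * B₁) / Λ ^ 2 := by
      rw [Complex.norm_real, Real.norm_eq_abs]; exact abs_sliceWeightFnD2_le hB₁ hB₂ hΛ hΛΛ' ω ξ
    have hW3 : ‖(sliceWeightFnD3 Λ Λ' ω ξ : ℂ)‖ ≤ (16 * B₃ + 24 * B₂) / Λ ^ 3 := by
      rw [Complex.norm_real, Real.norm_eq_abs]; exact abs_sliceWeightFnD3_le hB₂ hB₃ hΛ hΛΛ' ω ξ
    rw [sliceSymbolFnXiD3]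
    calc _ ≤ ‖(sliceWeightFnD3 Λ Λ' ω ξ : ℂ) * resolventFnXi c θ ω ξ‖ +
          ‖3 * ((sliceWeightFnD2 Λ Λ' ω ξ : ℂ) * resolventFnXiD1 c θ ω ξ)‖ +
          ‖3 * ((sliceWeightFnD1 Λ Λ' ω ξ : ℂ) * resolventFnXiD2 c θ ω ξ)‖ +
          ‖(sliceWeightFn Λ Λ' ω ξ : ℂ) * resolventFnXiD3 c θ ω ξ‖ := by
          refine (norm_add_le _ _).trans (add_le_add ((norm_add_le _ _).trans (add_le_add (norm_add_le _ _) le_rfl)) le_rfl)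
      _ ≤ (16 * B₃ + 24 * B₂) / Λ ^ 3 * (4 * c / Λ) + 3 * ((8 * B₂ + 4 * B₁) / Λ ^ 2 * (16 * c / Λ ^ 2)) +
          3 * (4 * B₁ / Λ * (128 * c / Λ ^ 3)) + 1 * (1536 * c / Λ ^ 4) := by
          refine add_le_add (add_le_add (add_le_add ?_ ?_) ?_) ?_
          · rw [norm_mul]; exact mul_le_mul hW3 hR (norm_nonneg _) (by positivity)
          · rw [norm_mul, norm_mul, Complex.norm_ofNat]
            exact mul_le_mul_of_nonneg_left (mul_le_mul hW2 hR1 (norm_nonneg _) (by positivity)) (by norm_num)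
          · rw [norm_mul, norm_mul, Complex.norm_ofNat]
            exact mul_le_mul_of_nonneg_left (mul_le_mul hW1 hR2 (norm_nonneg _) (by positivity)) (by norm_num)
          · rw [norm_mul]; exact mul_le_mul hW hR3 (norm_nonneg _) zero_le_one
      _ = (64 * B₃ + 480 * B₂ + 1728 * B₁ + 1536) * c / Λ ^ 4 := by field_simp; ring

end Xi

end Literature.MathematicalPhysics.QuantumLattice

end
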